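import Summits.KontsevichZagierPeriods.KontsevichZagierPeriods.Theorems.PlanarSAZylev.Negative.Kit

/-!
# `PlanarSAZylev` (stmt-KontsevichZagierPeriods-9848) — negative side: the clause "modulo null sets" is load-bearing on both sides

* `planarSAZylev_false_exact`: with the null-set clause DELETED (exact equidecomposability of `r`,
  `r'` themselves by one change-of-variables instance) the crux is FALSE: `(0,1)²` vs
  `(0,1)² ∪ {(5,5)}` satisfy the hypothesis (two domain-additivity instances,
  `sq_sub_sqPt_mem_planarGroup`) but are not ONE instance apart — a map differentiable within the
  convex open square has preconnected image, and the first coordinate of `(0,1)² ∪ {(5,5)}` takes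
  the values `1/2`, `5`, not `2` (`not_mem_changeOfVariablesRel_sq_sqPt`).
* `planarSAZylev_false_sourceExact`: discarding null sets on the TARGET side only is still false,
  even for the open square as source: `(0,1)²` vs the slit square `(0,1)² ∖ {x = 1/2}`
  (`volume_midLine = 0`, `sq_sub_slit_mem_planarGroup`): a preconnected full-measure image inside
  the slit square has abscissae on one side of `1/2` and misses an open half of area `1/2`.
Refuter, cdisprove cycle 1; kit in `Negative/Kit.lean`.  Everything is `sorry`-free.
[Kontsevich–Zagier 2001 §1.2; Sah 1979 Ch. 1 Thm 3.1 (Zylev)]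
-/

noncomputable section

open Set MeasureTheory MvPolynomial
open Literature.NumberTheory.Transcendental Literature.ModelTheory.ExponentialFields
open Summit.KontsevichZagierPeriods.KontsevichZagierPeriods.Theses.SymplecticScissors

namespace Summit.KontsevichZagierPeriods.SymplecticScissors.PlanarSAZylevNegative

open PlanarK0InjectiveNegative (planarGens planarGroup eq_of_of_sub_of_eq
  of_mem_planarGroup_of_volume_eq_zero)

/-! ## §1 Exact equidecomposability fails -/

/-- The hypothesis of the crux holds for `(0,1)²` versus `(0,1)² ∪ {q}` (they differ by the null
region `{q}`: one domain-additivity instance among planar integrand-1 representations plus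
`[{q}] ≡ 0`). [folklore] -/
theorem sq_sub_sqPt_mem_planarGroup : KZ.of sqRep - KZ.of sqPtRep ∈ planarGroup := by
  have hg : ∀ s : KZ.IntegralRep 2, (∀ p ∈ s.domain, s.integrand p = 1) →
      KZ.of s ∈ AddSubgroup.closure planarGens :=
    fun s hs => AddSubgroup.subset_closure ⟨s, hs, rfl⟩
  have hsq := hg sqRep (integrand_oneRep_eq_one _ _ _)
  have hpt := hg ptRep (integrand_oneRep_eq_one _ _ _)
  have hsqpt := hg sqPtRep (integrand_oneRep_eq_one _ _ _)
  have h1 : KZ.of sqPtRep - KZ.of sqRep - KZ.of ptRep ∈ planarGroup := by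
    refine AddSubgroup.subset_closure ⟨Or.inl ?_, ?_⟩
    · refine ⟨2, sqPtRep, sqRep, ptRep, rfl, ?_, fun _ _ => rfl, fun _ _ => rfl, rfl⟩
      exact measure_mono_null inter_subset_right volume_singleton_qpt
    · exact AddSubgroup.sub_mem _ (AddSubgroup.sub_mem _ hsqpt hsq) hpt
  have h2 : KZ.of ptRep ∈ planarGroup :=
    of_mem_planarGroup_of_volume_eq_zero ptRep (integrand_oneRep_eq_one _ _ _) volume_singleton_qpt
  have : KZ.of sqRep - KZ.of sqPtRep = -(KZ.of ptRep) - (KZ.of sqPtRep - KZ.of sqRep - KZ.of ptRep) := by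
    abel
  rw [this]
  exact planarGroup.sub_mem (planarGroup.neg_mem h2) h1

/-- The crux with the null-set clause DELETED: exact equidecomposability of `r` and `r'`
themselves by one change-of-variables instance (stated here only to be negated). -/
def PlanarSAZylevExact : Prop :=
  ∀ r r' : KZ.IntegralRep 2, (∀ p ∈ r.domain, r.integrand p = 1) →
    (∀ p ∈ r'.domain, r'.integrand p = 1) → KZ.of r - KZ.of r' ∈ planarGroup →
    KZ.of r - KZ.of r' ∈ KZ.changeOfVariablesRel

/-- `[(0,1)²] − [(0,1)² ∪ {q}]` is NOT one change-of-variables instance: a map differentiable within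
the (convex, hence connected) open square has preconnected image, but the first coordinate of
`(0,1)² ∪ {(5,5)}` takes the values `1/2` and `5` and not `2`. [folklore] -/
theorem not_mem_changeOfVariablesRel_sq_sqPt :
    KZ.of sqRep - KZ.of sqPtRep ∉ KZ.changeOfVariablesRel := by
  rintro ⟨n, ρ, ρ', Φ, Φ', -, hder, -, hdom, -, heq⟩
  have hne : (⟨2, sqRep⟩ : Σ k, KZ.IntegralRep k) ≠ ⟨2, sqPtRep⟩ := by
    intro e
    have hd : sqRep.domain = sqPtRep.domain :=
      congrArg KZ.IntegralRep.domain (eq_of_heq (Sigma.mk.inj_iff.mp e).2)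
    exact qpt_not_mem_sq (show qpt ∈ sqRep.domain by rw [hd]; exact Or.inr rfl)
  obtain ⟨h1, h2⟩ := eq_of_of_sub_of_eq hne heq
  cases h1
  cases h2
  have hdom' : sq ∪ {qpt} = Φ '' sq := hdom
  have hcont : ContinuousOn Φ sq := fun x hx => (hder x hx).continuousWithinAt
  have hpre : IsPreconnected ((fun p : Fin 2 → ℝ => p 0) '' (sq ∪ {qpt})) := by
    have h := convex_sq.isPreconnected.image Φ hcont
    rw [← hdom'] at h
    exact h.image _ (continuous_apply 0).continuousOn
  rw [isPreconnected_iff_ordConnected] at hpre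
  have hhalf : (1 / 2 : ℝ) ∈ (fun p : Fin 2 → ℝ => p 0) '' (sq ∪ {qpt}) :=
    ⟨fun _ => 1 / 2, Or.inl (mem_sq.mpr fun _ => by norm_num), rfl⟩
  have hfive : (5 : ℝ) ∈ (fun p : Fin 2 → ℝ => p 0) '' (sq ∪ {qpt}) := ⟨qpt, Or.inr rfl, rfl⟩
  have htwo : (2 : ℝ) ∈ (fun p : Fin 2 → ℝ => p 0) '' (sq ∪ {qpt}) :=
    hpre.out hhalf hfive ⟨by norm_num, by norm_num⟩
  obtain ⟨p, hp | hp, hp0⟩ := htwo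
  · have := (mem_sq.mp hp 0).2
    dsimp only at hp0
    linarith
  · rw [mem_singleton_iff] at hp
    subst hp
    norm_num [qpt] at hp0

/-- **Any proof must discard null sets**: exact planar Zylev is FALSE (`(0,1)²` vs `(0,1)² ∪ {q}`). [folklore] -/
theorem planarSAZylev_false_exact : ¬ PlanarSAZylevExact := fun h =>
  not_mem_changeOfVariablesRel_sq_sqPt (h _ _ (integrand_oneRep_eq_one _ _ _)
    (integrand_oneRep_eq_one _ _ _) sq_sub_sqPt_mem_planarGroup)

/-! ## §2 Discarding null sets on the target side only is still not enough -/

/-- The vertical line `{x = 1/2}`. [folklore] -/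
def midLine : Set (Fin 2 → ℝ) := {x | x 0 = ((1 / 2 : ℚ) : ℝ)}

/-- The vertical line is `ℚ`-semialgebraic. [folklore] -/
theorem isSemialgebraic_midLine : IsSemialgebraic ℚ midLine := isSemialgebraic_coord_eq 0 (1 / 2)

/-- The vertical line is Lebesgue-null (`{1/2} × ℝ`). [folklore] -/
theorem volume_midLine : volume midLine = 0 := by
  have h : midLine = Set.pi univ (Fin.cons ({((1 / 2 : ℚ) : ℝ)} : Set ℝ) (fun _ => univ)) := by
    ext x
    simp [midLine, Set.mem_pi, Fin.forall_fin_succ]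
  rw [h, volume_pi, Measure.pi_pi]
  simp [Fin.prod_univ_succ]

/-- The slit square `(0,1)² ∖ {x = 1/2}` (open, two components, full measure in the square). [folklore] -/
def slit : Set (Fin 2 → ℝ) := sq \ midLine

/-- The slit square is `ℚ`-semialgebraic. [folklore] -/
theorem isSemialgebraic_slit : IsSemialgebraic ℚ slit := isSemialgebraic_sq.diff isSemialgebraic_midLine

/-- `[(0,1)² ∖ {x = 1/2}, 1]`. [folklore] -/
def slitRep : KZ.IntegralRep 2 :=
  oneRep slit isSemialgebraic_slit (((measure_mono sdiff_subset).trans_lt (by simp [volume_sq])).ne)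

/-- `[(0,1)² ∩ {x = 1/2}, 1]` — the null slit itself. [folklore] -/
def cutRep : KZ.IntegralRep 2 :=
  oneRep (sq ∩ midLine) (isSemialgebraic_sq.inter isSemialgebraic_midLine)
    ((measure_mono_null inter_subset_right volume_midLine).trans_lt ENNReal.zero_lt_top |>.ne)

/-- The hypothesis of the crux holds for `(0,1)²` versus the slit square (one cut along a null line). [folklore] -/
theorem sq_sub_slit_mem_planarGroup : KZ.of sqRep - KZ.of slitRep ∈ planarGroup := by
  have hg : ∀ s : KZ.IntegralRep 2, (∀ p ∈ s.domain, s.integrand p = 1) →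
      KZ.of s ∈ AddSubgroup.closure planarGens :=
    fun s hs => AddSubgroup.subset_closure ⟨s, hs, rfl⟩
  have hnull : volume (sq ∩ midLine) = 0 := measure_mono_null inter_subset_right volume_midLine
  have h1 : KZ.of sqRep - KZ.of slitRep - KZ.of cutRep ∈ planarGroup := by
    refine AddSubgroup.subset_closure ⟨Or.inl ?_, ?_⟩
    · refine ⟨2, sqRep, slitRep, cutRep, ?_, ?_, fun _ _ => rfl, fun _ _ => rfl, rfl⟩
      · show sq = sq \ midLine ∪ sq ∩ midLine
        rw [union_comm, inter_union_sdiff]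
      · exact measure_mono_null inter_subset_right hnull
    · exact AddSubgroup.sub_mem _ (AddSubgroup.sub_mem _ (hg sqRep (integrand_oneRep_eq_one _ _ _))
        (hg slitRep (integrand_oneRep_eq_one _ _ _))) (hg cutRep (integrand_oneRep_eq_one _ _ _))
  have h2 : KZ.of cutRep ∈ planarGroup :=
    of_mem_planarGroup_of_volume_eq_zero cutRep (integrand_oneRep_eq_one _ _ _) hnull
  have : KZ.of sqRep - KZ.of slitRep = (KZ.of sqRep - KZ.of slitRep - KZ.of cutRep) + KZ.of cutRep := by
    abel
  rw [this]
  exact planarGroup.add_mem h1 h2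

/-- The right open half `(1/2,1) × (0,1)` of the square. [folklore] -/
def rightHalf : Set (Fin 2 → ℝ) := Set.pi univ fun i => Ioo ((![1 / 2, 0] : Fin 2 → ℝ) i) 1

/-- The left open half `(0,1/2) × (0,1)` of the square. [folklore] -/
def leftHalf : Set (Fin 2 → ℝ) := Set.pi univ fun i => Ioo 0 ((![1 / 2, 1] : Fin 2 → ℝ) i)

/-- The right half has positive area. [folklore] -/
theorem volume_rightHalf_ne_zero : volume rightHalf ≠ 0 := by
  have := Real.volume_pi_Ioo (a := (![1 / 2, 0] : Fin 2 → ℝ)) (b := fun _ => 1)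
  rw [rightHalf, this]
  norm_num [Fin.prod_univ_succ]

/-- The left half has positive area. [folklore] -/
theorem volume_leftHalf_ne_zero : volume leftHalf ≠ 0 := by
  have := Real.volume_pi_Ioo (a := fun _ : Fin 2 => (0 : ℝ)) (b := (![1 / 2, 1] : Fin 2 → ℝ))
  rw [leftHalf, this]
  norm_num [Fin.prod_univ_succ]

/-- Points of the right half: in the square, abscissa `> 1/2`. [folklore] -/
theorem mem_rightHalf {x : Fin 2 → ℝ} (hx : x ∈ rightHalf) : x ∈ sq ∧ (1 / 2 : ℝ) < x 0 := by
  have h0 : x 0 ∈ Ioo ((![1 / 2, 0] : Fin 2 → ℝ) 0) 1 := hx 0 (mem_univ _)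
  have h1 : x 1 ∈ Ioo ((![1 / 2, 0] : Fin 2 → ℝ) 1) 1 := hx 1 (mem_univ _)
  simp only [Matrix.cons_val_zero, Matrix.cons_val_one, mem_Ioo] at h0 h1
  exact ⟨mem_sq.mpr (Fin.forall_fin_two.mpr ⟨⟨by linarith [h0.1], h0.2⟩, h1⟩), h0.1⟩

/-- Points of the left half: in the square, abscissa `< 1/2`. [folklore] -/
theorem mem_leftHalf {x : Fin 2 → ℝ} (hx : x ∈ leftHalf) : x ∈ sq ∧ x 0 < (1 / 2 : ℝ) := by
  have h0 : x 0 ∈ Ioo 0 ((![1 / 2, 1] : Fin 2 → ℝ) 0) := hx 0 (mem_univ _)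
  have h1 : x 1 ∈ Ioo 0 ((![1 / 2, 1] : Fin 2 → ℝ) 1) := hx 1 (mem_univ _)
  simp only [Matrix.cons_val_zero, Matrix.cons_val_one, mem_Ioo] at h0 h1
  exact ⟨mem_sq.mpr (Fin.forall_fin_two.mpr ⟨⟨h0.1, by linarith [h0.2]⟩, h1⟩), h0.2⟩

/-- The crux with null sets discarded on the TARGET side only (the source representation kept
whole; stated here only to be negated). -/
def PlanarSAZylevSourceExact : Prop :=
  ∀ r r' : KZ.IntegralRep 2, (∀ p ∈ r.domain, r.integrand p = 1) →
    (∀ p ∈ r'.domain, r'.integrand p = 1) → KZ.of r - KZ.of r' ∈ planarGroup →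
    ∃ s' : KZ.IntegralRep 2, s'.domain ⊆ r'.domain ∧ volume (r'.domain \ s'.domain) = 0 ∧
      (∀ p ∈ s'.domain, s'.integrand p = 1) ∧ KZ.of r - KZ.of s' ∈ KZ.changeOfVariablesRel

/-- **Null sets must be discarded on the SOURCE side too, even when the source is the open square**:
`(0,1)²` versus the slit square. [folklore] -/
theorem planarSAZylev_false_sourceExact : ¬ PlanarSAZylevSourceExact := by
  intro h
  obtain ⟨s', hs', hnull, -, hcov⟩ := h sqRep slitRep (integrand_oneRep_eq_one _ _ _)
    (integrand_oneRep_eq_one _ _ _) sq_sub_slit_mem_planarGroup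
  have hs'' : s'.domain ⊆ slit := hs'
  have hhalf_mem : (fun _ => (1 / 2 : ℝ)) ∈ sq := mem_sq.mpr fun _ => by norm_num
  obtain ⟨n, ρ, ρ', Φ, Φ', -, hder, -, hdom, -, heq⟩ := hcov
  have hne : (⟨2, sqRep⟩ : Σ k, KZ.IntegralRep k) ≠ ⟨2, s'⟩ := by
    intro e
    have hd : sq ⊆ slit := by
      have : sqRep.domain = s'.domain :=
        congrArg KZ.IntegralRep.domain (eq_of_heq (Sigma.mk.inj_iff.mp e).2)
      exact fun x hx => hs'' (this ▸ hx)
    exact (hd hhalf_mem).2 (by simp [midLine])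
  obtain ⟨h1, h2⟩ := eq_of_of_sub_of_eq hne heq
  cases h1
  cases h2
  have hdom' : s'.domain = Φ '' sq := hdom
  have hcont : ContinuousOn Φ sq := fun x hx => (hder x hx).continuousWithinAt
  have hpre : IsPreconnected ((fun p : Fin 2 → ℝ => p 0) '' s'.domain) := by
    rw [hdom']
    exact (convex_sq.isPreconnected.image Φ hcont).image _ (continuous_apply 0).continuousOn
  rw [isPreconnected_iff_ordConnected] at hpre
  have havoid : ∀ p ∈ s'.domain, p 0 ≠ 1 / 2 := fun p hp e =>
    (hs'' hp).2 (by simp [midLine, e])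
  have hside : (∀ p ∈ s'.domain, p 0 < 1 / 2) ∨ (∀ p ∈ s'.domain, 1 / 2 < p 0) := by
    by_contra hcon
    push Not at hcon
    obtain ⟨⟨a, ha, ha'⟩, ⟨b, hb, hb'⟩⟩ := hcon
    have ha2 : 1 / 2 < a 0 := lt_of_le_of_ne ha' (havoid a ha).symm
    have hb2 : b 0 < 1 / 2 := lt_of_le_of_ne hb' (havoid b hb)
    have hmid : (1 / 2 : ℝ) ∈ (fun p : Fin 2 → ℝ => p 0) '' s'.domain :=
      hpre.out ⟨b, hb, rfl⟩ ⟨a, ha, rfl⟩ ⟨hb2.le, ha2.le⟩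
    obtain ⟨p, hp, hp0⟩ := hmid
    exact havoid p hp hp0
  rcases hside with hlt | hgt
  · have hsub : rightHalf ⊆ slitRep.domain \ s'.domain := by
      intro x hx
      obtain ⟨hxsq, hx0⟩ := mem_rightHalf hx
      refine ⟨⟨hxsq, fun e => ?_⟩, fun hxs => ?_⟩
      · simp only [midLine, mem_setOf_eq] at e
        rw [e] at hx0
        norm_num at hx0
      · linarith [hlt x hxs]
    exact volume_rightHalf_ne_zero (measure_mono_null hsub hnull)
  · have hsub : leftHalf ⊆ slitRep.domain \ s'.domain := by
      intro x hx
      obtain ⟨hxsq, hx0⟩ := mem_leftHalf hx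
      refine ⟨⟨hxsq, fun e => ?_⟩, fun hxs => ?_⟩
      · simp only [midLine, mem_setOf_eq] at e
        rw [e] at hx0
        norm_num at hx0
      · linarith [hgt x hxs]
    exact volume_leftHalf_ne_zero (measure_mono_null hsub hnull)

end Summit.KontsevichZagierPeriods.SymplecticScissors.PlanarSAZylevNegative
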